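import Literature.MathematicalPhysics.KineticTheory.HardSphereEulerProofs
import Literature.Analysis.FunctionSpaces.TorusSpaceTime
import HarnessLib

/-!
# Crux `EntropyAdmissibility` (stmt-AtomisticToContinuum-9903), line `registered` — stub `stub_testTransportIdentity` (GE2)

GE2 of the lead's skeleton: the test-function transport identity on `[0, τ] × 𝕋³`,
`∫_{(0,τ]} ∫_{𝕋³} (h ∂ₜφ + h ⟪v, ∇φ⟫) − ∫ h φ(τ) + ∫ h φ(0) = 0`
for constants `h : ℝ`, `v : ℝ³` and a test function `φ` jointly smooth on `[0, T) × 𝕋³`, `τ < T`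
("a constant state produces no entropy against any test function").

Proof (deterministic calculus, no particles). For every `t ∈ [0, T)` the flux term vanishes,
`∫ ⟪v, ∇φ(t)⟫ = ∫ ∂ᵥ φ(t) = 0` (`Torus.integral_lineDeriv_eq_zero`: translation invariance of the
Haar measure of `𝕋³`), so the slice integral is `h ∫ ∂ₜφ(t)`. The function `E(t) = ∫ φ(t, x) dx`
has one-sided derivative `E'(t) = ∫ ∂ₜφ(t, x) dx` within `[0, T)`
(`Torus.IsSmoothSpaceTimeOn.hasDerivWithinAt_integral`, differentiation under the integral sign),
`E'` is continuous on `[0, T)` (`Torus.IsSmoothSpaceTimeOn.continuousOn_integral` applied to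
`∂ₜφ`, which is again jointly smooth, `Torus.IsSmoothSpaceTimeOn.timeDerivWithin`), and the
fundamental theorem of calculus (`intervalIntegral.integral_eq_sub_of_hasDeriv_right_of_le`) gives
`∫_{(0,τ]} E' = E(τ) − E(0)`; the identity follows by `ring`. References: Březina–Feireisl,
J. Math. Soc. Japan 70 (2018), Def. 2.9 (the renormalised entropy balance tested against `φ`);
L. C. Evans, *Partial Differential Equations* (2010), App. C.2 (no boundary terms on the torus).
-/

noncomputable section

open MeasureTheory Filter Set
open scoped Topology ContDiff InnerProductSpace

namespace Summit.AtomisticToContinuum.HydrodynamicLimit.Theorems.EABirthGE2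

open Literature.MathematicalPhysics.KineticTheory
open Literature.Analysis.FunctionSpaces

/-! ## Slice identities on `𝕋³` -/

/-- The flux of a constant vector against a gradient vanishes on the torus:
`∫_{𝕋³} ⟪v, ∇k⟫ = ∫_{𝕋³} ∂ᵥ k = 0` for smooth `k`. -/
theorem integral_inner_const_gradient_eq_zero {k : T3 → ℝ} (hk : Torus.IsSmooth k) (v : V3) :
    ∫ x, inner ℝ v (Torus.gradient k x) = 0 := by
  have h : (fun x => inner ℝ v (Torus.gradient k x)) = fun x => Torus.lineDeriv k x v := by
    funext x
    rw [real_inner_comm, Torus.inner_gradient_left,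
      Torus.lineDeriv_eq_fderiv_apply (hk.isContDiff (by simp))]
  rw [h]
  exact Torus.integral_lineDeriv_eq_zero hk v

/-- The time slices of the tested identity: for `t ∈ [0, T)`,
`∫ (h ∂ₜφ(t) + h ⟪v, ∇φ(t)⟫) = h ∫ ∂ₜφ(t)`. -/
theorem integral_slice_eq {T : ℝ} {φ : ℝ → T3 → ℝ} (hφ : Torus.IsSmoothSpaceTimeOn (Ico 0 T) φ)
    {t : ℝ} (ht : t ∈ Ico 0 T) (h : ℝ) (v : V3) :
    ∫ x, (h * Torus.timeDerivWithin (Ico 0 T) φ t x + h * inner ℝ v (Torus.gradient (φ t) x)) =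
      h * ∫ x, Torus.timeDerivWithin (Ico 0 T) φ t x := by
  have hU : UniqueDiffOn ℝ (Ico 0 T) := uniqueDiffOn_Ico 0 T
  have i1 : Integrable (fun x => h * Torus.timeDerivWithin (Ico 0 T) φ t x) :=
    (hφ.isSmooth_timeDerivWithin hU ht).integrable.const_mul h
  have hg : Torus.IsSmooth (Torus.gradient (φ t)) := (hφ.isSmooth_slice ht).gradient
  have i2 : Integrable (fun x => h * inner ℝ v (Torus.gradient (φ t) x)) :=
    (continuous_const.inner hg.continuous).integrable_unitAddTorus.const_mul h
  rw [integral_add i1 i2, integral_const_mul, integral_const_mul,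
    integral_inner_const_gradient_eq_zero (hφ.isSmooth_slice ht) v, mul_zero, add_zero]

/-- The fundamental theorem of calculus for `E(t) = ∫ φ(t, x) dx` on `[0, τ] ⊆ [0, T)`:
`∫_{(0,τ]} (∫ ∂ₜφ(t, x) dx) dt = ∫ φ(τ) − ∫ φ(0)`. -/
theorem integral_Ioc_integral_timeDerivWithin_eq {T τ : ℝ} (hτ : τ ∈ Ico 0 T) {φ : ℝ → T3 → ℝ}
    (hφ : Torus.IsSmoothSpaceTimeOn (Ico 0 T) φ) :
    ∫ t in Ioc 0 τ, ∫ x, Torus.timeDerivWithin (Ico 0 T) φ t x = (∫ x, φ τ x) - ∫ x, φ 0 x := by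
  have hU : UniqueDiffOn ℝ (Ico 0 T) := uniqueDiffOn_Ico 0 T
  have hderiv : ∀ t ∈ Ico 0 T, HasDerivWithinAt (fun s => ∫ x, φ s x)
      (∫ x, Torus.timeDerivWithin (Ico 0 T) φ t x) (Ico 0 T) t := fun t ht =>
    hφ.hasDerivWithinAt_integral (convex_Ico 0 T) ht
  have hcont : ContinuousOn (fun s => ∫ x, φ s x) (Icc 0 τ) := fun s hs =>
    ((hderiv s ⟨hs.1, hs.2.trans_lt hτ.2⟩).continuousWithinAt).mono (Icc_subset_Ico_right hτ.2)
  have hder : ∀ s ∈ Ioo 0 τ, HasDerivWithinAt (fun s => ∫ x, φ s x)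
      (∫ x, Torus.timeDerivWithin (Ico 0 T) φ s x) (Ioi s) s := by
    intro s hs
    have hsT : s ∈ Ico 0 T := ⟨hs.1.le, hs.2.trans hτ.2⟩
    exact ((hderiv s hsT).hasDerivAt (Ico_mem_nhds hs.1 hsT.2)).hasDerivWithinAt
  have hE'cont : ContinuousOn (fun s => ∫ x, Torus.timeDerivWithin (Ico 0 T) φ s x) (Ico 0 T) :=
    (hφ.timeDerivWithin hU).continuousOn_integral (convex_Ico 0 T)
  have hint : IntervalIntegrable (fun s => ∫ x, Torus.timeDerivWithin (Ico 0 T) φ s x) volume 0 τ :=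
    (hE'cont.mono (Icc_subset_Ico_right hτ.2)).intervalIntegrable_of_Icc hτ.1
  have hftc := intervalIntegral.integral_eq_sub_of_hasDeriv_right_of_le hτ.1 hcont hder hint
  rwa [intervalIntegral.integral_of_le hτ.1] at hftc

/-! ## The stub -/

/-- Signature of GE2 (verbatim the skeleton's `Sig.stub_testTransportIdentity`). -/
def Sig.stub_testTransportIdentity : Prop :=
  ∀ (T τ : ℝ), τ ∈ Ico 0 T → ∀ φ : ℝ → T3 → ℝ,
    Literature.Analysis.FunctionSpaces.Torus.IsSmoothSpaceTimeOn (Ico 0 T) φ →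
    ∀ (h : ℝ) (v : V3),
      (∫ t in Ioc 0 τ, ∫ x, (h * Literature.Analysis.FunctionSpaces.Torus.timeDerivWithin (Ico 0 T) φ t x +
          h * inner ℝ v (Literature.Analysis.FunctionSpaces.Torus.gradient (φ t) x))) -
        (∫ x, h * φ τ x) + ∫ x, h * φ 0 x = 0

/-- **Stub GE2** (crux stmt-AtomisticToContinuum-9903, line `registered`): the test-function
transport identity `∫_{(0,τ]}∫(h ∂ₜφ + h ⟪v, ∇φ⟫) − ∫ h φ(τ) + ∫ h φ(0) = 0` on `[0, τ] × 𝕋³` for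
constants `h`, `v` — a constant state produces no entropy against any test function. -/
theorem stub_testTransportIdentity : Sig.stub_testTransportIdentity := by
  intro T τ hτ φ hφ h v
  have hcongr : ∫ t in Ioc 0 τ, ∫ x, (h * Torus.timeDerivWithin (Ico 0 T) φ t x +
      h * inner ℝ v (Torus.gradient (φ t) x)) =
      ∫ t in Ioc 0 τ, h * ∫ x, Torus.timeDerivWithin (Ico 0 T) φ t x :=
    setIntegral_congr_fun measurableSet_Ioc fun t ht =>
      integral_slice_eq hφ ⟨ht.1.le, ht.2.trans_lt hτ.2⟩ h v
  rw [hcongr, integral_const_mul, integral_Ioc_integral_timeDerivWithin_eq hτ hφ,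
    integral_const_mul, integral_const_mul]
  ring

end Summit.AtomisticToContinuum.HydrodynamicLimit.Theorems.EABirthGE2

end
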